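import Literature.AnabelianGeometry.AbsoluteAnabelian.AbsTopIII.KummerTowerDegreesDescentProofs
import Literature.AnabelianGeometry.AbsoluteAnabelian.AbsTopIII.KummerTowerNotKummerFaithfulProofs
import Mathlib.NumberTheory.PrimesCongruentOne
import HarnessLib

/-!
# [AbsTopIII] Rmk. 1.5.3 (ii) holds: the Kummer tower `ℚ_p(p^{1/ℓ^∞})` is torally Kummer-faithful
# and not Kummer-faithful

Proof-only companion (no new definitions) of `AbsTopIII/KummerFaithful.lean` (abc-iut-L4-t1,
p404026), closing FACT-LIST row F-0368: the named fact `Rmk_1_5_3_ii` —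
S. Mochizuki, *Topics in Absolute Anabelian Geometry III*, §1, Rmk. 1.5.3 (ii), manuscript p. 33:
"one may construct an example of a field which is torally Kummer-faithful, but not Kummer-faithful"
— is a THEOREM of the tree (`Rmk_1_5_3_ii_holds`).  Print's example is Tamagawa's (a rank-one
summand of the `p`-adic Tate module of a CM elliptic curve); ours is the elementary Kummer tower
`k = ℚ_p(α_0, α_1, …) ⊆ ℚ̄_p`, `α_0 = p`, `α_{n+1}^ℓ = α_n`, `ℓ ≠ p` primes:

* NOT Kummer-faithful: `KummerTowerNotKummerFaithfulProofs` (the Tate curve `E_p` acquires the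
  divisible subgroup `ℚ_ℓ/ℤ_ℓ ∋ φ(α_1) ≠ O` of rational points);
* TORALLY Kummer-faithful (`isTorallyKummerFaithful_rootTower`, this file): a finite extension `M`
  of `k` embeds into `ℚ̄_p` inside a tower `S_n = ℚ_p(α_n, T)` (`T` finite) of finite-dimensional
  subfields; an element `x` of the tower with `N`-th roots in the tower for every `N` is `1`
  (`eq_one_of_tower_divisible`): by radical descent (`KummerTowerDegreesDescentProofs`) its
  `p`-power roots lie in a fixed layer `S_{n₀}`, so `x` is a root of unity
  (`exists_pow_eq_one_of_forall_exists_pow_prime_pow_eq`); a prime `r ≠ ℓ` dividing its order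
  would produce roots of unity of unbounded order in a fixed layer (radical descent again, against
  `exists_torsion_bound`), and `r = ℓ` would produce `ℓ^{k+1}` roots of unity pairwise at distance `1`
  in a layer `S_m` whose residue field is too small: `e · f ≤ [S_m : ℚ_p] ≤ [S_{n₀} : ℚ_p] · ℓ^m`
  with ramification witnessed by the `ℓ^m` norm classes of the powers of `α_m`
  (`exists_norm_sub_lt_one`, `norm_root_pow_ne`).

HONEST FRAMING: a classical construction replacing print's CM example; OUR kernel proof of the
existence statement as typed (`IsKummerFaithful` records the torus and abelian-variety clauses of
Def. 1.5); nothing here bears on [IUTchIII] Cor. 3.12.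
[cite: MochizukiAbsTopIII2015, Rmk 1.5.3 (ii) p.33]
-/

noncomputable section

open scoped Classical

namespace Literature.AnabelianGeometry.AbsoluteAnabelian.AbsTopIII

open Polynomial IntermediateField Literature.NumberTheory.LFunctions Literature.NumberTheory

variable {p : ℕ} [Fact p.Prime]

/-! ## §1. Divisible elements of an `ℓ`-Kummer tower are trivial -/

section Main

variable {S : ℕ → IntermediateField ℚ_[p] (PadicAlgCl p)} {ℓ : ℕ} {α : ℕ → PadicAlgCl p}
  [∀ n, FiniteDimensional ℚ_[p] (S n)]

/-- Distinct powers `η^a ≠ η^b` (`a, b <` the order of `η`, a power of the prime `ℓ ≠ p`) of a root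
of unity of `ℓ`-power order are at distance `≥ 1` (prime-to-`p` roots of unity do not approach `1`,
the tree's `PadicRootsOfUnity.eq_zero_of_one_add_pow_eq_one`).
[cite: MochizukiAbsTopIII2015, Rmk 1.5.3 (ii) p.33] -/
theorem one_le_norm_pow_sub_pow (hℓ : ℓ.Prime) (hℓp : ℓ ≠ p) {η : PadicAlgCl p} {k : ℕ}
    (hord : orderOf η = ℓ ^ k) {a b : ℕ} (hab : a < b) (hb : b < ℓ ^ k) :
    1 ≤ ‖η ^ a - η ^ b‖ := by
  by_contra hlt
  rw [not_le] at hlt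
  have hηk : η ^ ℓ ^ k = 1 := by rw [← hord, pow_orderOf_eq_one]
  have hη1 : ‖η‖ = 1 :=
    PadicRootsOfUnity.norm_eq_one_of_pow_eq_one (pow_pos hℓ.pos k) hηk
  set y := η ^ (b - a) - 1 with hy
  have hrew : η ^ a - η ^ b = -(η ^ a * y) := by
    rw [hy, mul_sub, mul_one, ← pow_add, Nat.add_sub_cancel' hab.le]
    ring
  have hy1 : ‖y‖ < 1 := by
    rw [hrew, norm_neg, norm_mul, norm_pow, hη1, one_pow, one_mul] at hlt
    exact hlt
  have hpow : (1 + y) ^ ℓ ^ k = 1 := by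
    rw [hy, add_sub_cancel, ← pow_mul, mul_comm, pow_mul, hηk, one_pow]
  have hndvd : ¬ p ∣ ℓ ^ k := fun h =>
    hℓp ((Nat.prime_dvd_prime_iff_eq (Fact.out : p.Prime) hℓ).mp
      ((Fact.out : p.Prime).dvd_of_dvd_pow h)).symm
  have hy0 : y = 0 := PadicRootsOfUnity.eq_zero_of_one_add_pow_eq_one hndvd hy1 hpow
  have hone : η ^ (b - a) = 1 := by
    have := hy0
    rwa [hy, sub_eq_zero] at this
  exact pow_ne_one_of_lt_orderOf (Nat.sub_pos_of_lt hab).ne' (by rw [hord]; omega) hone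

/-- **Divisible elements of an `ℓ`-Kummer tower are trivial.**  Let `S₀ ≤ S₁ ≤ ⋯` be intermediate
fields of `ℚ̄_p / ℚ_p` of finite degree with `α_n ∈ S_n`, `α_0 = p`, `α_{n+1}^ℓ = α_n` and
`S_{n+1} ⊆ ℚ_p(S_n, α_{n+1})` (`ℓ ≠ p` primes).  If `x ≠ 0` lies in the tower and has an `N`-th root
in the tower for every `N ≥ 1`, then `x = 1`.  [cite: MochizukiAbsTopIII2015, Rmk 1.5.3 (ii) p.33] -/
theorem eq_one_of_tower_divisible (hℓ : ℓ.Prime) (hℓp : ℓ ≠ p) (h0 : α 0 = (p : PadicAlgCl p))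
    (hα : ∀ n, α (n + 1) ^ ℓ = α n) (hS1 : ∀ n, α n ∈ S n) (hS2 : ∀ n, S n ≤ S (n + 1))
    (hS3 : ∀ n, S (n + 1) ≤ adjoin ℚ_[p] ((S n : Set (PadicAlgCl p)) ∪ {α (n + 1)}))
    {x : PadicAlgCl p} (hx : ∃ n, x ∈ S n) (hx0 : x ≠ 0)
    (hdiv : ∀ N : ℕ, 0 < N → ∃ n, ∃ y ∈ S n, y ^ N = x) : x = 1 := by
  have hpP : (p : ℕ).Prime := Fact.out
  -- a layer `S_{n₀}` containing `x` and the `ℓ`-th and `p`-th roots of unity of the tower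
  obtain ⟨nx, hnx⟩ := hx
  obtain ⟨nℓ, hnℓ⟩ := exists_layer_rootsOfUnity hS2 hℓ.pos
  obtain ⟨np, hnp⟩ := exists_layer_rootsOfUnity hS2 hpP.pos
  set n₀ := max nx (max nℓ np) with hn₀
  have Hℓ : ∀ ζ : PadicAlgCl p, ζ ^ ℓ = 1 → (∃ m, ζ ∈ S m) → ζ ∈ S n₀ := fun ζ h1 h2 =>
    tower_mono hS2 ((le_max_left _ _).trans (le_max_right _ _)) (hnℓ ζ h1 h2)
  have Hp : ∀ ζ : PadicAlgCl p, ζ ^ p = 1 → (∃ m, ζ ∈ S m) → ζ ∈ S n₀ := fun ζ h1 h2 =>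
    tower_mono hS2 ((le_max_right _ _).trans (le_max_right _ _)) (hnp ζ h1 h2)
  have hxn₀ : x ∈ S n₀ := tower_mono hS2 (le_max_left _ _) hnx
  -- `p`-descent: the `p^k`-th roots of `x` may be taken in `S_{n₀}`, so `x` is a root of unity
  have hpdiv : ∀ k, ∃ z ∈ S n₀, z ^ p ^ k = x := fun k =>
    exists_pow_eq_of_tower_divisible hℓ h0 hα hS1 hS2 hS3 hpP hℓp.symm Hℓ Hp k x hxn₀ hx0
      (hdiv (p ^ k) (pow_pos hpP.pos k))
  obtain ⟨M, hM, hxM⟩ := exists_pow_eq_one_of_forall_exists_pow_prime_pow_eq (S n₀) hxn₀ hx0 hpdiv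
  -- suppose `x ≠ 1`, and let `r` be a prime factor of its order `o`
  by_contra hx1
  have hopos : 0 < orderOf x := orderOf_pos_iff.mpr (isOfFinOrder_iff_pow_eq_one.mpr ⟨M, hM, hxM⟩)
  have ho1 : orderOf x ≠ 1 := fun h => hx1 (orderOf_eq_one_iff.mp h)
  obtain ⟨r, hr, hro⟩ := Nat.exists_prime_and_dvd ho1
  -- `x' = x^{o/r}` has order `r` and is again divisible in the tower
  set x' := x ^ (orderOf x / r) with hx'
  have hx'r : x' ^ r = 1 := by rw [hx', ← pow_mul, Nat.div_mul_cancel hro, pow_orderOf_eq_one]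
  have hx'1 : x' ≠ 1 :=
    pow_ne_one_of_lt_orderOf (Nat.div_pos (Nat.le_of_dvd hopos hro) hr.pos).ne'
      (Nat.div_lt_self hopos hr.one_lt)
  have hx'0 : x' ≠ 0 := pow_ne_zero _ hx0
  have hx'div : ∀ N : ℕ, 0 < N → ∃ n, ∃ y ∈ S n, y ^ N = x' := by
    intro N hN
    obtain ⟨n, y, hy, hyN⟩ := hdiv N hN
    exact ⟨n, y ^ (orderOf x / r), pow_mem hy _, by rw [← pow_mul, mul_comm, pow_mul, hyN]⟩
  have hx'n₀ : x' ∈ S n₀ := pow_mem hxn₀ _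
  by_cases hrℓ : r = ℓ
  · -- `r = ℓ`: roots of unity of order `ℓ^{k+1}` in the tower, for every `k`
    set C₀ := Module.finrank ℚ_[p] (S n₀) with hC₀
    set k := p ^ C₀ with hk
    have hkbig : p ^ C₀ < ℓ ^ (k + 1) :=
      (Nat.lt_pow_self hℓ.one_lt).trans_le (Nat.pow_le_pow_right hℓ.pos (Nat.le_succ k))
    obtain ⟨m₁, η, hη, hηk⟩ := hx'div (ℓ ^ k) (pow_pos hℓ.pos k)
    have hη1 : η ^ ℓ ^ (k + 1) = 1 := by rw [pow_succ, pow_mul, hηk, ← hrℓ, hx'r]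
    have hηne : ¬ η ^ ℓ ^ k = 1 := by rw [hηk]; exact hx'1
    haveI : Fact ℓ.Prime := ⟨hℓ⟩
    have hord : orderOf η = ℓ ^ (k + 1) := orderOf_eq_prime_pow hηne hη1
    set m := max m₁ n₀ with hm
    have hηm : η ∈ S m := tower_mono hS2 (le_max_left _ _) hη
    have hn₀m : n₀ ≤ m := le_max_right _ _
    -- degrees: `[S_m : ℚ_p] / ℓ^m ≤ C₀`
    obtain ⟨km, hkm, hfin⟩ := exists_finrank_eq_mul_pow' hℓ h0 hα hS1 hS2 hS3 Hℓ hn₀m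
    have hquot : Module.finrank ℚ_[p] (S m) / ℓ ^ m ≤ C₀ := by
      rw [hfin]
      refine Nat.div_le_of_le_mul ?_
      rw [mul_comm]
      exact Nat.mul_le_mul_right _ (Nat.pow_le_pow_right hℓ.pos hkm)
    -- pigeonhole among the powers of `η`, against the `ℓ^m` norm classes of the powers of `α_m`
    obtain ⟨i, j, hij, hlt⟩ := exists_norm_sub_lt_one p (S m) (e := ℓ ^ m)
      (fun i : Fin (ℓ ^ m) => α m ^ (i : ℕ)) (fun i => pow_mem (hS1 m) _)
      (fun i => pow_ne_zero _ (root_ne_zero hℓ h0 hα m)) (norm_root_pow_ne hℓ h0 hα m)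
      (pow_pos hℓ.pos m) (N := ℓ ^ (k + 1)) (fun i => η ^ (i : ℕ)) (fun i => pow_mem hηm _)
      (fun i => by
        rw [norm_pow, PadicRootsOfUnity.norm_eq_one_of_pow_eq_one (pow_pos hℓ.pos (k + 1)) hη1,
          one_pow])
      ((Nat.pow_le_pow_right hpP.pos hquot).trans_lt hkbig)
    rcases lt_or_gt_of_ne (Fin.val_ne_of_ne hij) with h | h
    · exact absurd hlt (not_lt.mpr (one_le_norm_pow_sub_pow hℓ hℓp hord h j.isLt))
    · rw [norm_sub_rev] at hlt
      exact absurd hlt (not_lt.mpr (one_le_norm_pow_sub_pow hℓ hℓp hord h i.isLt))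
  · -- `r ≠ ℓ`: `r`-descent into a layer containing the `r`-th roots of unity, against its torsion bound
    obtain ⟨nr, hnr⟩ := exists_layer_rootsOfUnity hS2 hr.pos
    set n₁ := max n₀ nr with hn₁
    have Hℓ' : ∀ ζ : PadicAlgCl p, ζ ^ ℓ = 1 → (∃ m, ζ ∈ S m) → ζ ∈ S n₁ := fun ζ h1 h2 =>
      tower_mono hS2 (le_max_left _ _) (Hℓ ζ h1 h2)
    have Hr' : ∀ ζ : PadicAlgCl p, ζ ^ r = 1 → (∃ m, ζ ∈ S m) → ζ ∈ S n₁ := fun ζ h1 h2 =>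
      tower_mono hS2 (le_max_right _ _) (hnr ζ h1 h2)
    have hx'n₁ : x' ∈ S n₁ := tower_mono hS2 (le_max_left _ _) hx'n₀
    obtain ⟨B, hB, hBtors⟩ := exists_torsion_bound p (S n₁)
    obtain ⟨z, hz, hzB⟩ := exists_pow_eq_of_tower_divisible hℓ h0 hα hS1 hS2 hS3 hr hrℓ Hℓ' Hr' B
      x' hx'n₁ hx'0 (hx'div (r ^ B) (pow_pos hr.pos B))
    have hz1 : z ^ r ^ (B + 1) = 1 := by rw [pow_succ, pow_mul, hzB, hx'r]
    have hzne : ¬ z ^ r ^ B = 1 := by rw [hzB]; exact hx'1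
    haveI : Fact r.Prime := ⟨hr⟩
    have hord : orderOf z = r ^ (B + 1) := orderOf_eq_prime_pow hzne hz1
    have hzBtors : z ^ B = 1 := hBtors z hz (r ^ (B + 1)) (pow_pos hr.pos _) hz1
    have hdvd : r ^ (B + 1) ∣ B := by rw [← hord]; exact orderOf_dvd_of_pow_eq_one hzBtors
    have hle : r ^ (B + 1) ≤ B := Nat.le_of_dvd hB hdvd
    have hlt : B < r ^ (B + 1) :=
      (Nat.lt_pow_self hr.one_lt).trans_le (Nat.pow_le_pow_right hr.pos (Nat.le_succ B))
    omega

end Main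

/-! ## §2. The concrete tower `S_n = ℚ_p(α_n, T)` -/

section Concrete

variable {ℓ : ℕ} {α : ℕ → PadicAlgCl p} (T : Finset (PadicAlgCl p))

/-- The layers `S_n = ℚ_p(α_n, T)` contain `α_n`. [cite: MochizukiAbsTopIII2015, Rmk 1.5.3 (ii) p.33] -/
theorem mem_layer_self (n : ℕ) : α n ∈ adjoin ℚ_[p] (insert (α n) (T : Set (PadicAlgCl p))) :=
  subset_adjoin _ _ (Set.mem_insert _ _)

/-- The layers increase (`α_n = α_{n+1}^ℓ`). [cite: MochizukiAbsTopIII2015, Rmk 1.5.3 (ii) p.33] -/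
theorem layer_le_succ (hα : ∀ n, α (n + 1) ^ ℓ = α n) (n : ℕ) :
    adjoin ℚ_[p] (insert (α n) (T : Set (PadicAlgCl p))) ≤
      adjoin ℚ_[p] (insert (α (n + 1)) (T : Set (PadicAlgCl p))) := by
  refine adjoin_le_iff.mpr ?_
  rintro x (rfl | hx)
  · rw [← hα n]
    exact pow_mem (mem_layer_self T (n + 1)) _
  · exact subset_adjoin _ _ (Set.mem_insert_of_mem _ hx)

/-- `S_{n+1} ⊆ ℚ_p(S_n, α_{n+1})`. [cite: MochizukiAbsTopIII2015, Rmk 1.5.3 (ii) p.33] -/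
theorem layer_succ_le (n : ℕ) :
    adjoin ℚ_[p] (insert (α (n + 1)) (T : Set (PadicAlgCl p))) ≤
      adjoin ℚ_[p] ((adjoin ℚ_[p] (insert (α n) (T : Set (PadicAlgCl p))) : Set (PadicAlgCl p)) ∪
        {α (n + 1)}) := by
  refine adjoin.mono _ _ _ ?_
  rintro x (rfl | hx)
  · exact Or.inr (Set.mem_singleton _)
  · exact Or.inl (subset_adjoin _ _ (Set.mem_insert_of_mem _ hx))

/-- The layers are finite-dimensional over `ℚ_p`. [cite: MochizukiAbsTopIII2015, Rmk 1.5.3 (ii) p.33] -/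
theorem finiteDimensional_layer (n : ℕ) :
    FiniteDimensional ℚ_[p] (adjoin ℚ_[p] (insert (α n) (T : Set (PadicAlgCl p)))) := by
  haveI : Finite (↥(T : Set (PadicAlgCl p))) := T.finite_toSet.to_subtype
  exact finiteDimensional_adjoin fun x _ => Algebra.IsIntegral.isIntegral (R := ℚ_[p]) x

/-- Every element of `ℚ_p(α_0, α_1, …, T)` lies in some layer `S_n = ℚ_p(α_n, T)`.
[cite: MochizukiAbsTopIII2015, Rmk 1.5.3 (ii) p.33] -/
theorem exists_mem_layer (hα : ∀ n, α (n + 1) ^ ℓ = α n) {x : PadicAlgCl p}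
    (hx : x ∈ adjoin ℚ_[p] (Set.range α ∪ (T : Set (PadicAlgCl p)))) :
    ∃ n, x ∈ adjoin ℚ_[p] (insert (α n) (T : Set (PadicAlgCl p))) := by
  have hmono : ∀ {m n : ℕ}, m ≤ n → adjoin ℚ_[p] (insert (α m) (T : Set (PadicAlgCl p))) ≤
      adjoin ℚ_[p] (insert (α n) (T : Set (PadicAlgCl p))) := fun {m n} h =>
    tower_mono (S := fun n => adjoin ℚ_[p] (insert (α n) (T : Set (PadicAlgCl p))))
      (layer_le_succ T hα) h
  refine adjoin_induction ℚ_[p]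
    (p := fun x _ => ∃ n, x ∈ adjoin ℚ_[p] (insert (α n) (T : Set (PadicAlgCl p))))
    (mem := ?_) (algebraMap := ?_) (add := ?_) (inv := ?_) (mul := ?_) hx
  · rintro x (⟨n, rfl⟩ | hx)
    · exact ⟨n, mem_layer_self T n⟩
    · exact ⟨0, subset_adjoin _ _ (Set.mem_insert_of_mem _ hx)⟩
  · exact fun x => ⟨0, IntermediateField.algebraMap_mem _ x⟩
  · rintro x y - - ⟨n, hn⟩ ⟨m, hm⟩
    exact ⟨max n m, add_mem (hmono (le_max_left _ _) hn) (hmono (le_max_right _ _) hm)⟩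
  · rintro x - ⟨n, hn⟩
    exact ⟨n, inv_mem hn⟩
  · rintro x y - - ⟨n, hn⟩ ⟨m, hm⟩
    exact ⟨max n m, mul_mem (hmono (le_max_left _ _) hn) (hmono (le_max_right _ _) hm)⟩

end Concrete

/-! ## §3. The Kummer tower is torally Kummer-faithful; Rmk. 1.5.3 (ii) holds -/

/-- **The Kummer tower `ℚ_p(p^{1/ℓ^∞})` is torally Kummer-faithful** (`ℓ ≠ p` primes): for every
finite extension `M` of `k = ℚ_p(α_0, α_1, …)` one has `⋂_N (M^×)^N = {1}`.  Embed `M` into `ℚ̄_p`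
over `k` (`IsAlgClosed.lift`); the image lies in the tower `S_n = ℚ_p(α_n, T)`, `T` the image of a
`k`-basis of `M`, and `eq_one_of_tower_divisible` applies.
[cite: MochizukiAbsTopIII2015, Rmk 1.5.3 (ii) p.33] -/
theorem isTorallyKummerFaithful_rootTower {ℓ : ℕ} (hℓ : ℓ.Prime) (hℓp : ℓ ≠ p)
    {α : ℕ → PadicAlgCl p} (h0 : α 0 = (p : PadicAlgCl p)) (hα : ∀ n, α (n + 1) ^ ℓ = α n) :
    IsTorallyKummerFaithful (adjoin ℚ_[p] (Set.range α) : IntermediateField ℚ_[p] (PadicAlgCl p)) := by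
  set K := adjoin ℚ_[p] (Set.range α) with hK
  refine ⟨charZero_of_injective_algebraMap (algebraMap ℚ_[p] K).injective, fun M _ _ hfin => ?_⟩
  refine ⟨fun u hu => ?_⟩
  -- embed `M` into `ℚ̄_p` over `K`
  haveI : Algebra.IsAlgebraic K M := Algebra.IsAlgebraic.of_finite K M
  let σ : M →ₐ[K] PadicAlgCl p := IsAlgClosed.lift
  have hσ : Function.Injective σ := σ.toRingHom.injective
  -- the finite set `T` : images of a spanning family
  obtain ⟨n, s, hs⟩ := Module.Finite.exists_fin (R := K) (M := M)
  let T : Finset (PadicAlgCl p) := Finset.univ.image fun i => σ (s i)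
  -- every `σ m` lies in `ℚ_p(α_•, T)`
  have hmem : ∀ m : M, σ m ∈ adjoin ℚ_[p] (Set.range α ∪ (T : Set (PadicAlgCl p))) := by
    intro m
    have hm : m ∈ Submodule.span K (Set.range s) := by rw [hs]; exact Submodule.mem_top
    refine Submodule.span_induction ?_ ?_ ?_ ?_ hm
    · rintro _ ⟨i, rfl⟩
      refine subset_adjoin _ _ (Or.inr ?_)
      simp only [T, Finset.coe_image, Finset.coe_univ, Set.image_univ, Set.mem_range]
      exact ⟨i, rfl⟩
    · rw [map_zero]; exact zero_mem _
    · intro x y _ _ hx hy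
      rw [map_add]; exact add_mem hx hy
    · intro c x _ hx
      rw [map_smul, Algebra.smul_def]
      refine mul_mem ?_ hx
      change ((c : PadicAlgCl p)) ∈ _
      exact adjoin.mono _ _ _ Set.subset_union_left c.2
  -- the tower `S_n = ℚ_p(α_n, T)`
  let S : ℕ → IntermediateField ℚ_[p] (PadicAlgCl p) := fun n =>
    adjoin ℚ_[p] (insert (α n) (T : Set (PadicAlgCl p)))
  haveI : ∀ n, FiniteDimensional ℚ_[p] (S n) := fun n => finiteDimensional_layer T n
  -- `σ u` is divisible in the tower, hence `σ u = 1`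
  have hx0 : σ (u : M) ≠ 0 := (map_ne_zero_iff _ hσ).mpr u.ne_zero
  have hx : ∃ n, σ (u : M) ∈ S n := exists_mem_layer T hα (hmem u)
  have hdiv : ∀ N : ℕ, 0 < N → ∃ n, ∃ y ∈ S n, y ^ N = σ (u : M) := by
    intro N hN
    obtain ⟨v, hv⟩ := hu N hN
    obtain ⟨n, hn⟩ := exists_mem_layer T hα (hmem v)
    refine ⟨n, σ (v : M), hn, ?_⟩
    rw [← map_pow, ← Units.val_pow_eq_pow_val, hv]
  have h1 : σ (u : M) = 1 :=
    eq_one_of_tower_divisible (S := S) hℓ hℓp h0 hα (fun n => mem_layer_self T n)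
      (layer_le_succ T hα) (layer_succ_le T) hx hx0 hdiv
  exact Units.ext (hσ (by rw [h1, Units.val_one, map_one]))

/-- **[AbsTopIII] Rmk. 1.5.3 (ii) holds** — "one may construct an example of a field which is
torally Kummer-faithful, but not Kummer-faithful": the Kummer tower `ℚ_2(2^{1/ℓ^∞}) ⊆ ℚ̄_2` for a
prime `ℓ > 2` (torally Kummer-faithful by `isTorallyKummerFaithful_rootTower`, not Kummer-faithful
by `not_isKummerFaithful_of_rootTower` — the Tate curve `E_2` has a non-zero infinitely divisible
rational point).  FACT-LIST row F-0368 is thereby PROVED (for the tree's `IsKummerFaithful`, by a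
witness different from print's CM example). [cite: MochizukiAbsTopIII2015, Rmk 1.5.3 (ii) p.33] -/
theorem Rmk_1_5_3_ii_holds :
    Literature.AnabelianGeometry.AbsoluteAnabelian.AbsTopIII.Rmk_1_5_3_ii := by
  obtain ⟨ℓ, hℓ2, hℓ⟩ := Nat.exists_infinite_primes (2 + 1)
  have hℓp : ℓ ≠ 2 := by omega
  obtain ⟨α, h0, hα⟩ := exists_rootTower 2 ℓ hℓ.pos
  exact ⟨(adjoin ℚ_[2] (Set.range α) : IntermediateField ℚ_[2] (PadicAlgCl 2)), inferInstance,
    isTorallyKummerFaithful_rootTower hℓ hℓp h0 hα,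
    not_isKummerFaithful_of_rootTower h0 hα (adjoin ℚ_[2] (Set.range α))
      (fun n => subset_adjoin _ _ ⟨n, rfl⟩) hℓ⟩

end Literature.AnabelianGeometry.AbsoluteAnabelian.AbsTopIII

end
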